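import Mathlib
import Summits.ValiantsHypothesis.ValiantsHypothesis.Theorems.RigidityForcesSymmetryRankRigidMinimalReprLaplaceFiveSeparatedCaptureTwoTerm
import Summits.ValiantsHypothesis.ValiantsHypothesis.Theorems.RigidityForcesSymmetryRankRigidMinimalReprLaplaceFiveStarT2Relations

/-!
# ValiantsHypothesis / RigidityForcesSymmetry — crux `LaplaceOptimalFive` (stmt-ValiantsHypothesis-24813), symmetric capture:
# **A SQUARE-FREE SYMMETRIC TENSOR WITH ALL SLICES IN A PLANE OF QUADRICS VANISHES** (`SF ∩ ∂⁻¹(2-plane) = 0`)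

The prolongation brick for the 2-dimensional profiles (memo `pub/val-lit/lmr/NOTE-port2g5-24813-profile112-readout.md`, branch (γ) and the
homogeneous part `∂⁻¹V`; crit-3 g8 08:19:32Z P1): let `G` be a 3-tensor on `Fin 5` symmetric under the slot swaps `(0 1)`, `(1 2)`,
vanishing at repeated letters, whose slices `G(·,·,r)` all lie in the span of two symmetric matrices `v, v′` (ANY two).  Then `G = 0`.
Proof: write `G(p,q,r) = c_r v(p,q) + c′_r v′(p,q)`; the `(1 2)` symmetry is the two-term identity for `(v,c; −v′,c′)`:
(α) a non-zero minor of `(c,c′)` makes `v, v′` annihilate `⟨c,c′⟩^⊥` (✓ `twoTerm_binary`), so `G` is annihilated in a slot by that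
3-space and ✓ `LaplaceFiveStar.sqfree_symm3_eq_zero` applies; (β) `c ∥ c′` collapses `G` to `κ·c⊗c⊗c` (✓ `twoTerm_parallel`,
✓ `rankOne_of_tensor_symm`), killed by the repeated-letter vanishing.  Consequences: the profile `(0,0,2)`-type pieces and the `a = b = 0`
obligations of every profile `(·,·,2)` vanish; `∂⁻¹V ∩ SF = 0` for `dim V ≤ 2`.

* `cube_sqfree_eq_zero` — `κ·c⊗c⊗c` square-free ⇒ zero.
* ★ `sqfree_slices_in_plane_eq_zero` — the theorem.

Honest framing.  A brick; `CaptureIneqSym` general, the profile `(1,1,2)`, K1 on `K₃ ⊔ K₂`, `LaplaceOptimalFive` (OPEN · CONTESTED 72/120),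
`VP ≠ VNP` are NOT proved.  No definitions, no `sorry`.
-/

set_option linter.dupNamespace false
set_option autoImplicit false

namespace Summit.ValiantsHypothesis.ValiantsHypothesis.Theorems.RigidityForcesSymmetryRankRigidMinimalRepr

namespace LaplaceFiveSeparatedCapture

open Finset

/-- A multiple of a cube `κ·c⊗c⊗c` that vanishes at repeated letters vanishes identically. [folklore] -/
theorem cube_sqfree_eq_zero (κ : ℂ) (c : Fin 5 → ℂ) (hsq : ∀ p r, κ * (c p * c p * c r) = 0) (p q r : Fin 5) :
    κ * (c p * c q * c r) = 0 := by
  by_cases hq : c q = 0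
  · rw [hq]; ring
  · have h := hsq q r
    have h' : (κ * (c q * c r)) * c q = 0 := by linear_combination h
    rcases mul_eq_zero.mp h' with h1 | h1
    · linear_combination c p * h1
    · exact absurd h1 hq

/-- ★ **`SF ∩ ∂⁻¹(plane) = 0`.**  A `(0 1)`,`(1 2)`-symmetric tensor vanishing at repeated letters, all of whose slices `G(·,·,r)` lie in the
span of two symmetric matrices `v, v′`, is zero. [folklore] -/
theorem sqfree_slices_in_plane_eq_zero (v v' : Fin 5 → Fin 5 → ℂ) (hv : ∀ p q, v p q = v q p) (hv' : ∀ p q, v' p q = v' q p)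
    (G : Fin 5 → Fin 5 → Fin 5 → ℂ) (h12 : ∀ p q r, G p q r = G q p r) (h23 : ∀ p q r, G p q r = G p r q)
    (hsq : ∀ p r, G p p r = 0) (c c' : Fin 5 → ℂ) (hG : ∀ p q r, G p q r = c r * v p q + c' r * v' p q)
    (p q r : Fin 5) : G p q r = 0 := by
  -- the two-term identity for `(v, c; −v′, c′)` from the `(1 2)` symmetry
  have hS : ∀ p q r, v p q * c r - (fun p q => -v' p q) p q * c' r = v p r * c q - (fun p q => -v' p q) p r * c' q := by
    intro p q r
    have h := h23 p q r
    rw [hG, hG] at h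
    show v p q * c r - (-v' p q) * c' r = v p r * c q - (-v' p r) * c' q
    linear_combination h
  by_cases hmin : ∃ r₁ r₂, c r₁ * c' r₂ - c r₂ * c' r₁ ≠ 0
  · -- (α) binary: `v, v′` annihilate `⟨c,c′⟩^⊥`, hence so does `G` in its first slot
    obtain ⟨r₁, r₂, hm⟩ := hmin
    refine LaplaceFiveStar.sqfree_symm3_eq_zero G h12 h23 hsq c c' (fun y hyc hyc' b₀ c₀ => ?_) p q r
    have hyc1 : ∑ i, c i * y i = 0 := by rw [← hyc]; exact Finset.sum_congr rfl fun i _ => mul_comm _ _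
    have hyc2 : ∑ i, c' i * y i = 0 := by rw [← hyc']; exact Finset.sum_congr rfl fun i _ => mul_comm _ _
    have hb := twoTerm_binary v (fun p q => -v' p q) c c' hS r₁ r₂ hm y hyc1 hyc2 b₀
    have e1 : ∑ a, y a * G a b₀ c₀ = c c₀ * ∑ a, v b₀ a * y a + c' c₀ * ∑ a, v' b₀ a * y a := by
      rw [Finset.mul_sum, Finset.mul_sum, ← Finset.sum_add_distrib]
      exact Finset.sum_congr rfl fun a _ => by rw [h12 a b₀ c₀, hG, hv b₀ a, hv' b₀ a]; ring
    have e2 : ∑ a, v' b₀ a * y a = 0 := by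
      have := hb.2
      have h3 : ∑ a, -v' b₀ a * y a = -(∑ a, v' b₀ a * y a) := by
        rw [← Finset.sum_neg_distrib]; exact Finset.sum_congr rfl fun a _ => by ring
      rw [h3] at this; linear_combination -this
    rw [e1, hb.1, e2]; ring
  · -- (β) parallel: `G` collapses to a cube
    push Not at hmin
    have hmin' : ∀ r₁ r₂, c r₁ * c' r₂ = c r₂ * c' r₁ := fun r₁ r₂ => sub_eq_zero.mp (hmin r₁ r₂)
    by_cases hc : ∀ r, c r = 0
    · -- `G = v′ ⊗ c′`, symmetric ⇒ cube
      have hG' : ∀ p q r, G p q r = c' r * v' p q := fun p q r => by rw [hG, hc]; ring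
      by_cases hc' : ∀ r, c' r = 0
      · rw [hG', hc']; ring
      push Not at hc'
      obtain ⟨r₀, hr₀⟩ := hc'
      have hsym : ∀ p q r, v' p q * c' r = v' p r * c' q := by
        intro p q r; have h := h23 p q r; rw [hG', hG'] at h; linear_combination h
      have hr1 := rankOne_of_tensor_symm v' c' hv' hsym r₀ hr₀
      have hcube : ∀ p q r, G p q r = v' r₀ r₀ / c' r₀ ^ 2 * (c' p * c' q * c' r) := by
        intro p q r; rw [hG', hr1]; ring
      rw [hcube]
      exact cube_sqfree_eq_zero _ c' (fun p r => by rw [← hcube]; exact hsq p r) p q r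
    · push Not at hc
      obtain ⟨r₀, hr₀⟩ := hc
      have hcc := twoTerm_parallel c c' hmin' r₀ hr₀
      set β := c' r₀ / c r₀ with hβ
      have hc' : ∀ r, c' r = β * c r := fun r => by rw [hcc]; rfl
      have hG' : ∀ p q r, G p q r = c r * (v p q + β * v' p q) := fun p q r => by rw [hG, hc']; ring
      have hsym : ∀ p q r, (v p q + β * v' p q) * c r = (v p r + β * v' p r) * c q := by
        intro p q r; have h := h23 p q r; rw [hG', hG'] at h; linear_combination h
      have hws : ∀ p q, v p q + β * v' p q = v q p + β * v' q p := fun p q => by rw [hv p q, hv' p q]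
      have hr1 := rankOne_of_tensor_symm (fun p q => v p q + β * v' p q) c hws hsym r₀ hr₀
      have hcube : ∀ p q r, G p q r = (v r₀ r₀ + β * v' r₀ r₀) / c r₀ ^ 2 * (c p * c q * c r) := by
        intro p q r; rw [hG']; have := hr1 p q; rw [this]; ring
      rw [hcube]
      exact cube_sqfree_eq_zero _ c (fun p r => by rw [← hcube]; exact hsq p r) p q r

end LaplaceFiveSeparatedCapture

end Summit.ValiantsHypothesis.ValiantsHypothesis.Theorems.RigidityForcesSymmetryRankRigidMinimalRepr
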